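import Summits.Ventures.CertifiedArithmetic.LowPrec.Directed
import Literature.ComputerArithmetic.ConnollyHighamMary2021.StochasticRounding
import Mathlib.Data.Finset.Image

/-!
# Bridge: the value set of a minifloat format as a CHM number system; SR two-point law per format

HONEST FRAMING (venture CertifiedArithmetic / cell `pub-lowprec`): certified error envelopes and
provably optimal rounding/accumulation schemes for low-precision formats under stated cost models;
every table by two implementations; no hardware or vendor claims.

`valueSet φ : Finset ℚ` is the set of VALUES of the finite data of `φ`. The Connolly–Higham–Mary
rounding candidates `⌊x⌋ = max{y ∈ F : y ≤ x}`, `⌈x⌉ = min{y ∈ F : x ≤ y}` of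
`Literature/ComputerArithmetic/ConnollyHighamMary2021/StochasticRounding.lean` taken with
`F = valueSet φ` coincide, for `|x| ≤ maxRat`, with the values of the format's directed roundings
`roundDown φ x` / `roundUp φ x` of `Directed.lean` (`chm_roundDown_eq`, `chm_roundUp_eq`).
Consequently the typed CHM/El Arar et al. one-rounding results (Lemma 4.4 unbiasedness
`srMean_eq_self`, variance identity `srVar_eq`, bound `srVar_le_gap_sq_div_four`) apply verbatim
to stochastic rounding into any OCP/IEEE format of `Formats.lean`, with the two-point support
computed by the kernel-reducible `roundDown` / `roundUp` (restated here as `srMean_format`,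
`srVar_format`).
-/

namespace Literature.ComputerArithmetic.FloatingPoint

open Literature.ComputerArithmetic

namespace MiniFloat

variable {φ : Format}

/-- The finite set of values of the data of `φ` (both zeros give the one value `0`). [folklore] -/
def valueSet (φ : Format) : Finset ℚ := Finset.univ.image (MiniFloat.toRat (φ := φ))

/-- Membership in the value set. [folklore] -/
theorem mem_valueSet {v : ℚ} : v ∈ valueSet φ ↔ ∃ x : MiniFloat φ, x.toRat = v := by
  simp [valueSet]

/-- Every datum's value is in the value set. [folklore] -/
theorem toRat_mem_valueSet (x : MiniFloat φ) : x.toRat ∈ valueSet φ :=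
  mem_valueSet.mpr ⟨x, rfl⟩

/-- BRIDGE (down): for `|x| ≤ maxRat`, the CHM lower candidate over `valueSet φ` is the value of
`roundDown φ x`. [folklore] -/
theorem chm_roundDown_eq {x : ℚ} (h : |x| ≤ φ.maxRat) :
    ConnollyHighamMary2021.roundDown (valueSet φ) x = (roundDown φ x).toRat := by
  apply le_antisymm
  · -- the CHM candidate is a value ≤ x, hence ≤ our maximal one
    have hmem : ConnollyHighamMary2021.roundDown (valueSet φ) x ∈ valueSet φ :=
      ConnollyHighamMary2021.roundDown_mem ⟨_, toRat_mem_valueSet _, toRat_roundDown_le h⟩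
    obtain ⟨z, hz⟩ := mem_valueSet.mp hmem
    rw [← hz]
    exact toRat_le_roundDown h z (hz ▸ ConnollyHighamMary2021.roundDown_le _ _)
  · exact ConnollyHighamMary2021.le_roundDown_of_mem (toRat_mem_valueSet _) (toRat_roundDown_le h)

/-- BRIDGE (up): for `|x| ≤ maxRat`, the CHM upper candidate over `valueSet φ` is the value of
`roundUp φ x`. [folklore] -/
theorem chm_roundUp_eq {x : ℚ} (h : |x| ≤ φ.maxRat) :
    ConnollyHighamMary2021.roundUp (valueSet φ) x = (roundUp φ x).toRat := by
  apply le_antisymm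
  · exact ConnollyHighamMary2021.roundUp_le_of_mem (toRat_mem_valueSet _) (le_toRat_roundUp h)
  · have hmem : ConnollyHighamMary2021.roundUp (valueSet φ) x ∈ valueSet φ :=
      ConnollyHighamMary2021.roundUp_mem ⟨_, toRat_mem_valueSet _, le_toRat_roundUp h⟩
    obtain ⟨z, hz⟩ := mem_valueSet.mp hmem
    rw [← hz]
    exact roundUp_le_toRat h z (hz ▸ ConnollyHighamMary2021.le_roundUp _ _)

/-- SR INTO A FORMAT IS UNBIASED IN RANGE (CHM Lemma 4.4 instantiated): with
`p = probUp (valueSet φ) x`, `p · ↑x + (1 - p) · ↓x = x` where `↓x, ↑x` are the values of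
`roundDown φ x`, `roundUp φ x`, for every rational `|x| ≤ maxRat`.
[cite: ConnollyHighamMary2021, Lemma 4.4] -/
theorem srMean_format {x : ℚ} (h : |x| ≤ φ.maxRat) :
    ConnollyHighamMary2021.probUp (valueSet φ) x * (roundUp φ x).toRat
      + (1 - ConnollyHighamMary2021.probUp (valueSet φ) x) * (roundDown φ x).toRat = x := by
  have := ConnollyHighamMary2021.srMean_eq_self (valueSet φ) x
  unfold ConnollyHighamMary2021.srMean at this
  rwa [chm_roundUp_eq h, chm_roundDown_eq h] at this

/-- SR VARIANCE IN A FORMAT (El Arar et al. identity instantiated): the variance of the two-point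
law equals `(x - ↓x)(↑x - x)`, for `|x| ≤ maxRat`. [cite: ArarEtAl2023, §3] -/
theorem srVar_format {x : ℚ} (h : |x| ≤ φ.maxRat) :
    ConnollyHighamMary2021.srVar (valueSet φ) x
      = (x - (roundDown φ x).toRat) * ((roundUp φ x).toRat - x) := by
  rw [ConnollyHighamMary2021.srVar_eq, chm_roundDown_eq h, chm_roundUp_eq h]

end MiniFloat

end Literature.ComputerArithmetic.FloatingPoint
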